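import Mathlib
import Literature.NumberTheory.LFunctions.Zhang2022.ToolkitGaussUnsmoothingTrunc
import Literature.NumberTheory.LFunctions.Zhang2022.Section7XiZeroShortInterval
import Literature.NumberTheory.LFunctions.Zhang2022.Section11GCShortInterval
import Literature.NumberTheory.LFunctions.Zhang2022.SkeletonPartThree
import HarnessLib

/-!
# Zhang (2022) §12: the `g`-smoothing step for the twisted `ξ₀ⱼ`-sums at the printed weight
# `Λ = 𝓛³⁰` — ONE instance serving `Z22:§12.u024`, `u030` and the (12.11) bound

Topic `Literature/NumberTheory/LFunctions/Zhang2022` (Landau–Siegel audit tree; verdict-neutral).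
Y. Zhang, *Discrete mean estimates and the Landau–Siegel zero*, arXiv:2211.02515v1 (2022)
[Zhang2022LandauSiegel] — **an unrefereed manuscript under adjudication; nothing here asserts or denies
its Theorems 1–2 or anything about Landau–Siegel zeros.** ZHANG-L discharge lane, WP12; LIB-PLAN S-8a
(E3 of record = Q-19 engine + Q-32 truncation + the true-size short-interval mean).

The proofs of Lemmas 12.2 and 12.3 (p. 69 tex L3528 "By (4) and (4) [sic], for `|w| = α` we have
`Σ_{P″₁/dr<l<P″₂/dr} χ(l)ξ_j(l;d,r)/l^{1−β₆+w} = Σ_l …{g(P″₂/(drl)) − g(P″₁/(drl))} + O(𝓛⁻¹⁵)`";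
p. 70 tex L3564, the same with the single cutoff `P″₂/dr`) replace SHARP sums of
`χ(l)ξ₀ⱼ(l;d,r)l^{−(1−β₆+w)}` by sums weighted with `g = g_{𝓛³⁰}` of (4.1). What (4.2)–(4.3) alone do
not give is the size of the transition windows `|log(l/Z)| ≲ 𝓛⁻¹⁵`; the tree now has every input:
the unsmoothing engine (`GaussWeight.norm_sum_Ico_sub_tsum_mul_gWeight_le_of_localShortInterval`,
Q-19/Q-32) and the TRUE-SIZE short-interval mean of `|ξ₀ⱼ(·;d,r)|`
(`XiZeroMajorant.xiZero_shortInterval_Ioc`: `Σ_{x<n≤x+y}|ξ₀ⱼ(n;d,r)| ≤ C e^{7B log(4x)}(r/φ(r))·y`,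
exponent ONE, `B = |b₁|+|b₂|+|b₃| ≤ 9π𝓛⁻⁹`). THIS FILE assembles them ONCE, for a generic cutoff
`Z ∈ [T, P″₂]` and a generic shift `w` with `|w| ≤ α` (so `w = 0` is allowed):

* `xi_sharp_sub_smooth_le` — an absolute `C ≥ 0` and, for each `c′`, a threshold `D₀` such that
  for `D ≥ D₀`, every character `χ (mod D)`, all `j`, `d, r ≥ 1`, `|w| ≤ α`, `T ≤ Z ≤ P″₂`:
  the smoothed series converges and
  `‖Σ_{1≤l<Z} χ(l)ξ₀ⱼ(l;d,r)l^{−(1−β₆+w)} − Σ_l χ(l)ξ₀ⱼ(l;d,r)l^{−(1−β₆+w)} g(Z/l)‖ ≤ C·(r/φ(r))·𝓛⁻¹⁵`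
  (`g = Skeleton.gW D = gWeight(𝓛³⁰)`). The factor `r/φ(r) ≤ ∏_{q∣dr}(1−q⁻¹)⁻¹` is the RELATIVE
  currency of record (RT-01′ / `Lemma84Rel`); an absolute `O(𝓛⁻¹⁵)` is not claimed.

Route (all kernel inputs in tree): coefficients `a(l) = χ(l)ξ₀ⱼ(l;d,r)l^{β₆−w}` (`a(l)/l` is the
summand), truncation height `N₀ = ⌈e⁴Z⌉`; local majorant `|a(l)| ≤ N₀^{α}|ξ₀ⱼ(l)|` (`|l^{−w}| ≤ l^α`,
`N₀^α ≤ e⁴`); local short-interval bound from `xiZero_shortInterval_Ioc` with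
`7B log(4N₀) ≤ 64π` (`log Z ≤ 𝓛⁹`); head `Σ_{n≤x₀}|ξ₀ⱼ| ≤ A₂(1)x₀²` and global `|a(l)| ≤ A₂(¼)l^{1/2}`
from the uniform divisor-class majorant `gC` (`exists_rpow_majorant_gC`); far tail
`A₂(¼)Z^{3/2}e^{6−16𝓛³⁰} ≤ A₂(¼)𝓛⁻¹⁵`; `√Λ = 𝓛¹⁵`.

Theorems only; 0 definitions; standard axioms.

## References

* Y. Zhang, arXiv:2211.02515v1 (2022), §12 pp. 69–70 (proofs of Lemmas 12.2–12.3, u024/u030);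
  §4 (4.1)–(4.3) p. 18; §7 p. 33 (`ξ₀ⱼ`). [cite: Zhang2022LandauSiegel, §12 pp. 69–70; §4 (4.2)–(4.3)]
* P. Shiu, J. reine angew. Math. 313 (1980) 161–170, Theorem 1 (via the tree's `Sieve.shiu_uniform`).
  [cite: Shiu1980, Theorem 1]
-/

noncomputable section

open Real Finset Complex

namespace Literature.NumberTheory.LFunctions.Zhang2022.XiZeroMajorant

open Literature.NumberTheory.LFunctions.Zhang2022.Skeleton
open Literature.NumberTheory.LFunctions.Zhang2022.GaussWeight

/-! ### Sizes for large `D` -/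

/-- `log x ≤ 2√x` for `x ≥ 0`. [folklore] -/
private theorem log_le_two_sqrt {x : ℝ} (hx : 0 ≤ x) : Real.log x ≤ 2 * Real.sqrt x := by
  have h := Real.log_le_rpow_div hx (by norm_num : (0 : ℝ) < 1 / 2)
  rw [Real.sqrt_eq_rpow]
  calc Real.log x ≤ x ^ (1 / 2 : ℝ) / (1 / 2) := h
    _ = 2 * x ^ (1 / 2 : ℝ) := by ring

/-- For `𝓛 ≥ 3844 = 62²`: `2 + 30 log 𝓛 ≤ 𝓛` (so `e²𝓛³⁰ ≤ e^{𝓛} ≤ T`). [folklore] -/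
private theorem two_add_thirty_log_le {L : ℝ} (hL : 3844 ≤ L) : 2 + 30 * Real.log L ≤ L := by
  have hL0 : 0 ≤ L := by linarith
  have hs : 62 ≤ Real.sqrt L := by
    rw [show (62 : ℝ) = Real.sqrt (62 ^ 2) by rw [Real.sqrt_sq (by norm_num)]]
    exact Real.sqrt_le_sqrt (by norm_num; linarith)
  have hlog := log_le_two_sqrt hL0
  have hsq : Real.sqrt L * Real.sqrt L = L := Real.mul_self_sqrt hL0
  nlinarith

/-- `𝓛 ≤ 𝓛^{1.1}` for `𝓛 ≥ 1`, hence `e^{𝓛} ≤ T = e^{𝓛^{1.1}}`. [cite: Zhang2022LandauSiegel, §2 p. 5] -/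
private theorem exp_ell_le_bigT {D : ℕ} (hL : 1 ≤ ell D) : Real.exp (ell D) ≤ bigT D := by
  rw [bigT, Real.exp_le_exp]
  calc ell D = ell D ^ (1 : ℝ) := (Real.rpow_one _).symm
    _ ≤ ell D ^ (1.1 : ℝ) := Real.rpow_le_rpow_of_exponent_le hL (by norm_num)

/-- `log P″₂ ≤ 𝓛⁹` for `𝓛 ≥ 3` (`P″₂ = P^{1/2}·D·𝓛⁵¹⁹`, `𝓛 + 519 log 𝓛 ≤ 520𝓛 ≤ 𝓛⁹/2`).
[cite: Zhang2022LandauSiegel, §12 p. 67] -/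
private theorem log_P2pp_le {D : ℕ} (hL : 3 ≤ ell D) : Real.log (P2pp D) ≤ ell D ^ 9 := by
  have hL0 : 0 < ell D := by linarith
  have hD1 : (1 : ℝ) < D := by
    by_contra h
    have h' : (D : ℝ) ≤ 1 := not_lt.mp h
    have : Real.log (D : ℝ) ≤ 0 := Real.log_nonpos (Nat.cast_nonneg D) h'
    have hℓ : ell D = Real.log (D : ℝ) := rfl
    linarith
  have hD0 : (0 : ℝ) < D := by linarith
  have hP0 : 0 < bigP D := by unfold bigP; exact Real.exp_pos _
  have hP : 0 < bigP D ^ (0.5 : ℝ) := Real.rpow_pos_of_pos hP0 _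
  have ht0 : 0 < t0 D := by rw [t0]; exact pow_pos hL0 _
  have hlogP : Real.log (bigP D) = ell D ^ 9 := by rw [bigP, Real.log_exp]
  have hlogD : Real.log (D : ℝ) = ell D := rfl
  rw [P2pp, Real.log_mul (mul_pos hP hD0).ne' ht0.ne', Real.log_mul hP.ne' hD0.ne',
    Real.log_rpow hP0, hlogP, hlogD, t0, Real.log_pow]
  have hlogL : Real.log (ell D) ≤ ell D := by
    have := Real.log_le_sub_one_of_pos hL0; linarith
  have h8 : (3 : ℝ) ^ 8 ≤ ell D ^ 8 := pow_le_pow_left₀ (by norm_num) hL 8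
  have h98 : ell D ^ 9 = ell D * ell D ^ 8 := by ring
  have hkey : 1040 * ell D ≤ ell D ^ 9 := by
    rw [h98]
    have : (1040 : ℝ) ≤ ell D ^ 8 := le_trans (by norm_num) h8
    nlinarith
  have h519 : ((519 : ℕ) : ℝ) * Real.log (ell D) ≤ 519 * ell D := by
    push_cast; nlinarith
  nlinarith

/-- `α = π/𝓛⁹ ≤ 1/4` for `𝓛 ≥ 3`. [cite: Zhang2022LandauSiegel, §2 (2.6)] -/
private theorem alpha_le_quarter' {D : ℕ} (hL : 3 ≤ ell D) : alpha D ≤ 1 / 4 := by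
  have h9 : (3 : ℝ) ^ 9 ≤ ell D ^ 9 := pow_le_pow_left₀ (by norm_num) hL 9
  rw [alpha, bigP, Real.log_exp, div_le_iff₀ (by linarith)]
  nlinarith [Real.pi_lt_d2]

/-- `α · (𝓛⁹ + 5) ≤ 4` for `𝓛 ≥ 3`. [cite: Zhang2022LandauSiegel, §2 (2.6)] -/
private theorem alpha_mul_le_four {D : ℕ} (hL : 3 ≤ ell D) : alpha D * (ell D ^ 9 + 5) ≤ 4 := by
  have h9 : (3 : ℝ) ^ 9 ≤ ell D ^ 9 := pow_le_pow_left₀ (by norm_num) hL 9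
  have h9pos : 0 < ell D ^ 9 := by linarith
  rw [alpha, bigP, Real.log_exp, div_mul_eq_mul_div, div_le_iff₀ h9pos]
  nlinarith [Real.pi_lt_d2, Real.pi_pos]

/-- `(9π/𝓛⁹)·7·(𝓛⁹ + 7) ≤ 64π` for `𝓛 ≥ 3`. [cite: Zhang2022LandauSiegel, §2 (2.13)] -/
private theorem seven_Bbound_le {D : ℕ} (hL : 3 ≤ ell D) :
    7 * (9 * π / ell D ^ 9) * (ell D ^ 9 + 7) ≤ 64 * π := by
  have h9 : (3 : ℝ) ^ 9 ≤ ell D ^ 9 := pow_le_pow_left₀ (by norm_num) hL 9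
  have h9pos : 0 < ell D ^ 9 := by linarith
  rw [show 7 * (9 * π / ell D ^ 9) * (ell D ^ 9 + 7) = (63 * π * (ell D ^ 9 + 7)) / ell D ^ 9 by
    field_simp; ring, div_le_iff₀ h9pos]
  nlinarith [Real.pi_pos]

/-! ### The coefficient `a(l) = χ(l)ξ₀ⱼ(l;d,r)l^{β₆−w}` -/

variable (c' : ℝ) {D : ℕ} (χ : DirichletCharacter ℂ D)

/-- `a(l)/l = χ(l)ξ₀ⱼ(l;d,r)/l^{1−β₆+w}` (`l ≠ 0`; and both sides vanish at `l = 0`).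
[cite: Zhang2022LandauSiegel, §12 p. 69] -/
private theorem coeff_div_eq (j d r : ℕ) (w : ℂ) (l : ℕ) :
    χ (l : ZMod D) * xiZero c' D j l d r * (l : ℂ) ^ (beta6 D - w) / l =
      χ (l : ZMod D) * xiZero c' D j l d r / (l : ℂ) ^ (1 - beta6 D + w) := by
  rcases Nat.eq_zero_or_pos l with rfl | hl
  · have h0 : xiZero c' D j 0 d r = 0 := by unfold xiZero; simp
    rw [h0, mul_zero, zero_mul, zero_div, zero_div]
  · have hl0 : (l : ℂ) ≠ 0 := by exact_mod_cast hl.ne'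
    have hpow : (l : ℂ) ^ (beta6 D - w) * (l : ℂ) ^ (1 - beta6 D + w) = l := by
      rw [← Complex.cpow_add _ _ hl0, show beta6 D - w + (1 - beta6 D + w) = 1 by ring,
        Complex.cpow_one]
    have hne : (l : ℂ) ^ (1 - beta6 D + w) ≠ 0 := by
      intro h
      rw [h, mul_zero] at hpow
      exact hl0 hpow.symm
    have h2 : (l : ℂ) ^ (beta6 D - w) = l / (l : ℂ) ^ (1 - beta6 D + w) := (eq_div_iff hne).mpr hpow
    have hkey : (l : ℂ) / (l : ℂ) ^ (1 - beta6 D + w) / l = ((l : ℂ) ^ (1 - beta6 D + w))⁻¹ := by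
      rw [div_div, mul_comm, ← div_div, div_self hl0, one_div]
    rw [h2, mul_div_assoc, mul_div_assoc, hkey, div_eq_mul_inv, mul_assoc]

/-- `‖l^{β₆−w}‖ ≤ l^{α}` for `l ≥ 1`, `‖w‖ ≤ α` (`β₆` purely imaginary). [cite: Zhang2022LandauSiegel, §2 (2.22)] -/
private theorem norm_cpow_shift_le {l : ℕ} (hl : 1 ≤ l) {w : ℂ} {α : ℝ} (hw : ‖w‖ ≤ α) :
    ‖(l : ℂ) ^ (beta6 D - w)‖ ≤ (l : ℝ) ^ α := by
  have hl0 : 0 < l := hl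
  rw [Complex.norm_natCast_cpow_of_pos hl0]
  have hre : (beta6 D - w).re = -w.re := by simp [beta6]
  rw [hre]
  have h1 : (1 : ℝ) ≤ l := by exact_mod_cast hl
  refine Real.rpow_le_rpow_of_exponent_le h1 ?_
  have := Complex.abs_re_le_norm w
  have := neg_le_of_abs_le this
  linarith

/-! ### The instance -/

set_option maxHeartbeats 400000 in
/-- **The `g`-smoothing step of §12 at the printed weight `Λ = 𝓛³⁰`, for the twisted `ξ₀ⱼ`-sums**
(serves `Z22:§12.u024` — two cutoffs `P″₂/dr`, `P″₁/dr` — and `u030`, p. 70, and the sharp sum of the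
(12.11) reduction at `w = 0`): there is an absolute `C ≥ 0`, and for every `c′` a threshold `D₀`,
such that for all `D ≥ D₀`, every Dirichlet character `χ (mod D)`, all `j`, all `d, r ≥ 1`, every `w`
with `‖w‖ ≤ α` and every cutoff `Z` with `T ≤ Z ≤ P″₂`:
`Σ_l χ(l)ξ₀ⱼ(l;d,r)l^{−(1−β₆+w)}g(Z/l)` converges and
`‖Σ_{1≤l<Z} χ(l)ξ₀ⱼ(l;d,r)l^{−(1−β₆+w)} − Σ_l χ(l)ξ₀ⱼ(l;d,r)l^{−(1−β₆+w)}g(Z/l)‖ ≤ C·(r/φ(r))·𝓛⁻¹⁵`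
(`g = Skeleton.gW D`, (4.1) with `Λ = 𝓛³⁰`). The relative factor `r/φ(r)` comes from the primes
`q ∣ r` where `|ξ₀ⱼ(q;d,r)| = |κ(q)| ≈ 2` (true-size short-interval mean `xiZero_shortInterval_Ioc`).
[cite: Zhang2022LandauSiegel, §12 pp. 69–70; §4 (4.2)–(4.3)] -/
theorem xi_sharp_sub_smooth_le : ∃ C : ℝ, 0 ≤ C ∧ ∀ c' : ℝ, ∃ D₀ : ℕ, ∀ (D : ℕ), D₀ ≤ D →
    ∀ (χ : DirichletCharacter ℂ D) (j d r : ℕ), 1 ≤ d → 1 ≤ r → ∀ w : ℂ, ‖w‖ ≤ alpha D →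
      ∀ Z : ℝ, bigT D ≤ Z → Z ≤ P2pp D →
        Summable (fun l : ℕ => χ (l : ZMod D) * xiZero c' D j l d r / (l : ℂ) ^ (1 - beta6 D + w) *
            (gW D (Z / l) : ℂ)) ∧
        ‖(∑ l ∈ Finset.Ico 1 ⌈Z⌉₊, χ (l : ZMod D) * xiZero c' D j l d r / (l : ℂ) ^ (1 - beta6 D + w)) -
            ∑' l : ℕ, χ (l : ZMod D) * xiZero c' D j l d r / (l : ℂ) ^ (1 - beta6 D + w) *
              (gW D (Z / l) : ℂ)‖ ≤ C * ((r : ℝ) / r.totient) * (ell D ^ 15)⁻¹ := by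
  -- the two uniform inputs: the true-size short-interval mean and the divisor-class majorant
  obtain ⟨C₁, x₀, hC₁, hx₀2, hShort⟩ := xiZero_shortInterval_Ioc
  obtain ⟨A₂, hA₂⟩ := exists_rpow_majorant_gC
  -- nonnegativity of the majorant constants
  have hA₂nn : ∀ δ : ℝ, 0 < δ → 0 ≤ A₂ δ := by
    intro δ hδ
    have h := hA₂ 0 1 δ hδ 1 le_rfl
    simp only [Nat.cast_one, Real.one_rpow, mul_one] at h
    exact le_trans (gC_nonneg 0 1 1) h
  have hA1 := hA₂nn 1 one_pos
  have hA4 := hA₂nn (1 / 4) (by norm_num)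
  -- the absolute constant
  set B₀ : ℝ := C₁ * Real.exp (64 * π) with hB₀
  set F₀ : ℝ := A₂ 1 * x₀ ^ 2 with hF₀
  have hB₀0 : 0 ≤ B₀ := by rw [hB₀]; positivity
  have hF₀0 : 0 ≤ F₀ := by rw [hF₀]; positivity
  clear_value B₀ F₀
  refine ⟨27 * (Real.exp 4 * B₀ + Real.exp 4 * F₀) / 2 + A₂ (1 / 4), by positivity, fun c' => ?_⟩
  -- the threshold: `𝓛 ≥ 3`, `B ≤ 9π/𝓛⁹`, `𝓛 ≥ 3844`, `𝓛 ≥ 2 + x₀`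
  refine ⟨max (⌈Real.exp (5 * |c'| * π + 3)⌉₊) (⌈Real.exp (3844 + x₀)⌉₊), ?_⟩
  intro D hD χ j d r hd hr w hw Z hTZ hZP
  have hD1 : ⌈Real.exp (5 * |c'| * π + 3)⌉₊ ≤ D := le_trans (le_max_left _ _) hD
  have hD2 : ⌈Real.exp (3844 + x₀)⌉₊ ≤ D := le_trans (le_max_right _ _) hD
  obtain ⟨hL3, hBsum⟩ := three_le_ell_and_Bsum_le hD1
  have hLbig : 3844 + x₀ ≤ ell D := by
    have hexp : Real.exp (3844 + x₀) ≤ D := le_trans (Nat.le_ceil _) (by exact_mod_cast hD2)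
    rw [ell]
    exact (Real.le_log_iff_exp_le (lt_of_lt_of_le (Real.exp_pos _) hexp)).mpr hexp
  have hx₀0 : 0 ≤ x₀ := by linarith
  have hL1 : 1 ≤ ell D := by linarith
  have hL0 : 0 < ell D := by linarith
  -- notation
  set L : ℝ := ell D with hLdef
  set Λ : ℝ := L ^ 30 with hΛdef
  set αD : ℝ := alpha D with hαdef
  have hα0 : 0 < αD := by rw [hαdef, alpha, bigP, Real.log_exp]; positivity
  have hα4 : αD ≤ 1 / 4 := alpha_le_quarter' hL3
  -- `T ≤ Z` gives the engine's range conditions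
  have hL3844 : 3844 ≤ L := by linarith
  have hTexp : Real.exp L ≤ bigT D := exp_ell_le_bigT hL1
  have hZexp : Real.exp L ≤ Z := le_trans hTexp hTZ
  have hZ0 : 0 < Z := lt_of_lt_of_le (Real.exp_pos _) hZexp
  have hZ1 : 1 ≤ Z := le_trans (Real.one_le_exp (by linarith)) hZexp
  have hΛ4 : 4 ≤ Λ := by
    rw [hΛdef]
    calc (4 : ℝ) ≤ 3 ^ 30 := by norm_num
      _ ≤ L ^ 30 := pow_le_pow_left₀ (by norm_num) hL3 30
  have hΛ1 : 1 ≤ Λ := by linarith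
  -- `e²Λ ≤ e^{L} ≤ Z`: `2 + 30 log L ≤ L`
  have hΛZ : Real.exp 2 * Λ ≤ Z := by
    refine le_trans ?_ hZexp
    have h := two_add_thirty_log_le hL3844
    have hΛpos : 0 < Λ := by linarith
    have hexp30 : Real.exp (30 * Real.log L) = L ^ 30 := by
      rw [show (30 : ℝ) * Real.log L = Real.log L * ((30 : ℕ) : ℝ) by push_cast; ring,
        ← Real.rpow_def_of_pos hL0, Real.rpow_natCast]
    calc Real.exp 2 * Λ = Real.exp (2 + 30 * Real.log L) := by
          rw [Real.exp_add, hexp30]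
      _ ≤ Real.exp L := Real.exp_le_exp.mpr h
  -- `e²x₀ ≤ e^{2+x₀} ≤ e^{L} ≤ Z`
  have hx₀Z : Real.exp 2 * x₀ ≤ Z := by
    refine le_trans ?_ hZexp
    have h1 : x₀ ≤ Real.exp x₀ := by have := Real.add_one_le_exp x₀; linarith
    calc Real.exp 2 * x₀ ≤ Real.exp 2 * Real.exp x₀ :=
          mul_le_mul_of_nonneg_left h1 (Real.exp_pos _).le
      _ = Real.exp (2 + x₀) := by rw [← Real.exp_add]
      _ ≤ Real.exp L := Real.exp_le_exp.mpr (by linarith)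
  have hx₀1 : 1 ≤ max x₀ 1 := le_max_right _ _
  -- truncation height
  set N₀ : ℕ := ⌈Real.exp 4 * Z⌉₊ with hN₀def
  have hN : Real.exp 4 * Z ≤ N₀ := Nat.le_ceil _
  have he4 : (1 : ℝ) ≤ Real.exp 4 := Real.one_le_exp (by norm_num)
  have hN₀le : (N₀ : ℝ) ≤ Real.exp 5 * Z := by
    have h1 : (N₀ : ℝ) < Real.exp 4 * Z + 1 := Nat.ceil_lt_add_one (by positivity)
    have h2 : Real.exp 4 * Z + 1 ≤ Real.exp 5 * Z := by
      have he : Real.exp 5 = Real.exp 4 * Real.exp 1 := by rw [← Real.exp_add]; norm_num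
      have he1 : (2 : ℝ) ≤ Real.exp 1 := by have := Real.add_one_le_exp (1 : ℝ); linarith
      have hZ4 : 1 ≤ Real.exp 4 * Z := one_le_mul_of_one_le_of_one_le he4 hZ1
      have hmono : Real.exp 4 * 2 * Z ≤ Real.exp 4 * Real.exp 1 * Z :=
        mul_le_mul_of_nonneg_right (mul_le_mul_of_nonneg_left he1 (Real.exp_pos 4).le) hZ0.le
      rw [he]; linarith
    linarith
  have hN₀pos : (0 : ℝ) < N₀ := lt_of_lt_of_le (by positivity) hN
  clear_value N₀
  -- `log Z ≤ L⁹`, `log N₀ ≤ L⁹ + 5`, `log(4x) ≤ L⁹ + 7` for `x ≤ N₀`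
  have hlogZ : Real.log Z ≤ L ^ 9 :=
    le_trans (Real.log_le_log hZ0 hZP) (log_P2pp_le hL3)
  have hlogN₀ : Real.log N₀ ≤ L ^ 9 + 5 := by
    calc Real.log N₀ ≤ Real.log (Real.exp 5 * Z) := Real.log_le_log hN₀pos hN₀le
      _ = 5 + Real.log Z := by rw [Real.log_mul (Real.exp_pos _).ne' hZ0.ne', Real.log_exp]
      _ ≤ L ^ 9 + 5 := by linarith
  -- `c = N₀^{α} ≤ e⁴`
  set c : ℝ := (N₀ : ℝ) ^ αD with hcdef
  have hc0 : 0 ≤ c := by rw [hcdef]; positivity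
  have hc4 : c ≤ Real.exp 4 := by
    rw [hcdef, Real.rpow_def_of_pos hN₀pos, Real.exp_le_exp]
    calc Real.log N₀ * αD ≤ (L ^ 9 + 5) * αD := mul_le_mul_of_nonneg_right hlogN₀ hα0.le
      _ = αD * (L ^ 9 + 5) := by ring
      _ ≤ 4 := alpha_mul_le_four hL3
  clear_value c
  -- the coefficients and their majorants
  set a : ℕ → ℂ := fun l => χ (l : ZMod D) * xiZero c' D j l d r * (l : ℂ) ^ (beta6 D - w)
    with hadef
  set f₀ : ℕ → ℝ := fun l => ‖xiZero c' D j l d r‖ with hf₀def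
  have hf₀ : ∀ n, 0 ≤ f₀ n := fun n => norm_nonneg _
  have hnorm_a : ∀ n : ℕ, 1 ≤ n → ‖a n‖ ≤ f₀ n * (n : ℝ) ^ αD := by
    intro n hn
    simp only [hadef, hf₀def, norm_mul]
    calc ‖χ (n : ZMod D)‖ * ‖xiZero c' D j n d r‖ * ‖(n : ℂ) ^ (beta6 D - w)‖
        ≤ 1 * ‖xiZero c' D j n d r‖ * (n : ℝ) ^ αD :=
          mul_le_mul (mul_le_mul_of_nonneg_right (χ.norm_le_one _) (norm_nonneg _))
            (norm_cpow_shift_le hn hw) (norm_nonneg _) (by positivity)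
      _ = ‖xiZero c' D j n d r‖ * (n : ℝ) ^ αD := by rw [one_mul]
  -- local majorant: `‖a n‖ ≤ c·f₀ n` for `n ≤ N₀`
  have haf : ∀ n : ℕ, 1 ≤ n → n ≤ N₀ → ‖a n‖ ≤ c * f₀ n := by
    intro n hn hnN
    have hnα : (n : ℝ) ^ αD ≤ c := by
      rw [hcdef]
      exact Real.rpow_le_rpow (Nat.cast_nonneg n) (by exact_mod_cast hnN) hα0.le
    calc ‖a n‖ ≤ f₀ n * (n : ℝ) ^ αD := hnorm_a n hn
      _ ≤ f₀ n * c := mul_le_mul_of_nonneg_left hnα (hf₀ n)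
      _ = c * f₀ n := mul_comm _ _
  -- global majorant: `‖a n‖ ≤ A₂(¼)·n^{1/2}`
  have ha : ∀ n : ℕ, 1 ≤ n → ‖a n‖ ≤ A₂ (1 / 4) * (n : ℝ) ^ (1 / 2 : ℝ) := by
    intro n hn
    have hn1 : (1 : ℝ) ≤ n := by exact_mod_cast hn
    have hn0 : (0 : ℝ) < n := by linarith
    have hg : f₀ n ≤ A₂ (1 / 4) * (n : ℝ) ^ (1 / 4 : ℝ) :=
      le_trans (norm_xiZero_le_gC c' D (by omega) j d r) (hA₂ c' D (1 / 4) (by norm_num) n hn)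
    have hnα : (n : ℝ) ^ αD ≤ (n : ℝ) ^ (1 / 4 : ℝ) := Real.rpow_le_rpow_of_exponent_le hn1 hα4
    calc ‖a n‖ ≤ f₀ n * (n : ℝ) ^ αD := hnorm_a n hn
      _ ≤ (A₂ (1 / 4) * (n : ℝ) ^ (1 / 4 : ℝ)) * (n : ℝ) ^ (1 / 4 : ℝ) :=
          mul_le_mul hg hnα (by positivity) (by positivity)
      _ = A₂ (1 / 4) * (n : ℝ) ^ (1 / 2 : ℝ) := by
          rw [mul_assoc, ← Real.rpow_add hn0]; norm_num
  -- local short-interval bound at heights `x ≤ N₀`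
  have hLocal : ∀ x y : ℝ, max x₀ 1 ≤ x → x ≤ N₀ → Real.sqrt x ≤ y → y ≤ x →
      ∑ n ∈ Finset.Ioc ⌊x⌋₊ ⌊x + y⌋₊, f₀ n ≤ B₀ * ((r : ℝ) / r.totient) * y := by
    intro x y hx hxN hxy hyx
    have hx' : x₀ ≤ x := le_trans (le_max_left _ _) hx
    have hx1 : 1 ≤ x := le_trans (le_max_right _ _) hx
    have hx0 : 0 < x := by linarith
    have hy0 : 0 ≤ y := le_trans (Real.sqrt_nonneg _) hxy
    have h := hShort c' D j d r (by omega) (by omega) x y hx' hxy hyx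
    refine h.trans ?_
    -- `7B log(4x) ≤ 64π`
    have hlog4x : Real.log (4 * x) ≤ L ^ 9 + 7 := by
      have h4 : Real.log 4 ≤ 2 := by
        have : (4 : ℝ) ≤ Real.exp 2 := by
          have := Real.add_one_le_exp (2 : ℝ)
          have h2 : Real.exp 2 = Real.exp 1 * Real.exp 1 := by rw [← Real.exp_add]; norm_num
          have he1 : (2 : ℝ) ≤ Real.exp 1 := by have := Real.add_one_le_exp (1 : ℝ); linarith
          rw [h2]; nlinarith
        calc Real.log 4 ≤ Real.log (Real.exp 2) := Real.log_le_log (by norm_num) this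
          _ = 2 := Real.log_exp 2
      rw [Real.log_mul (by norm_num) hx0.ne']
      have : Real.log x ≤ Real.log N₀ := Real.log_le_log hx0 hxN
      linarith
    have hB : 7 * Bsum c' D * Real.log (4 * x) ≤ 64 * π := by
      have hB0 := Bsum_nonneg c' D
      have hlog0 : 0 ≤ Real.log (4 * x) := Real.log_nonneg (by linarith)
      calc 7 * Bsum c' D * Real.log (4 * x) ≤ 7 * (9 * π / ell D ^ 9) * (L ^ 9 + 7) := by
            have := mul_le_mul hBsum hlog4x hlog0 (by positivity)
            linarith
        _ ≤ 64 * π := seven_Bbound_le hL3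
    have hrφ : 0 ≤ (r : ℝ) / r.totient := by positivity
    calc C₁ * Real.exp (7 * Bsum c' D * Real.log (4 * x)) * ((r : ℝ) / r.totient) * y
        ≤ C₁ * Real.exp (64 * π) * ((r : ℝ) / r.totient) * y :=
          mul_le_mul_of_nonneg_right (mul_le_mul_of_nonneg_right
            (mul_le_mul_of_nonneg_left (Real.exp_le_exp.mpr hB) hC₁) hrφ) hy0
    _ = B₀ * ((r : ℝ) / r.totient) * y := by rw [hB₀]
  -- the head `Σ_{n ≤ max x₀ 1} f₀ ≤ A₂(1)·(max x₀ 1)² ≤ ...`; we use `x₀' = max x₀ 1`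
  set x₁ : ℝ := max x₀ 1 with hx₁def
  have hx₁0 : 0 ≤ x₁ := le_trans zero_le_one hx₀1
  have hSmall : ∑ n ∈ Finset.Icc 1 ⌊x₁⌋₊, f₀ n ≤ A₂ 1 * x₁ ^ 2 := by
    have hterm : ∀ n ∈ Finset.Icc 1 ⌊x₁⌋₊, f₀ n ≤ A₂ 1 * x₁ := by
      intro n hn
      rw [Finset.mem_Icc] at hn
      have hn1 : 1 ≤ n := hn.1
      have hnx : (n : ℝ) ≤ x₁ := le_trans (by exact_mod_cast hn.2) (Nat.floor_le hx₁0)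
      calc f₀ n ≤ A₂ 1 * (n : ℝ) ^ (1 : ℝ) :=
            le_trans (norm_xiZero_le_gC c' D (by omega) j d r) (hA₂ c' D 1 one_pos n hn1)
        _ = A₂ 1 * n := by rw [Real.rpow_one]
        _ ≤ A₂ 1 * x₁ := mul_le_mul_of_nonneg_left hnx hA1
    calc ∑ n ∈ Finset.Icc 1 ⌊x₁⌋₊, f₀ n ≤ ∑ n ∈ Finset.Icc 1 ⌊x₁⌋₊, A₂ 1 * x₁ :=
          Finset.sum_le_sum hterm
      _ = (⌊x₁⌋₊ : ℝ) * (A₂ 1 * x₁) := by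
          rw [Finset.sum_const, Nat.card_Icc, nsmul_eq_mul]; push_cast; ring
      _ ≤ x₁ * (A₂ 1 * x₁) := mul_le_mul_of_nonneg_right (Nat.floor_le hx₁0) (by positivity)
      _ = A₂ 1 * x₁ ^ 2 := by ring
  -- `x₁ ≤ ?`: the engine needs `e² x₁ ≤ Z`; `x₁ = max x₀ 1 ≤ x₀ + 1`
  have hx₁Z : Real.exp 2 * x₁ ≤ Z := by
    rcases le_total x₀ 1 with h | h
    · have : x₁ = 1 := by rw [hx₁def, max_eq_right h]
      rw [this, mul_one]
      exact le_trans (Real.exp_le_exp.mpr (by linarith)) hZexp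
    · have : x₁ = x₀ := by rw [hx₁def, max_eq_left h]
      rw [this]; exact hx₀Z
  -- APPLY the truncated unsmoothing wrapper (Q-32) at `k = 0`
  have hBr : 0 ≤ B₀ * ((r : ℝ) / r.totient) := by positivity
  obtain ⟨hsum, hle⟩ := norm_sum_Ico_sub_tsum_mul_gWeight_le_of_localShortInterval
    (a := a) (f₀ := f₀) (B := B₀ * ((r : ℝ) / r.totient)) (x₀ := x₁) (c := c) (N₀ := N₀)
    hf₀ hc0 haf hBr hx₀1 hLocal (F := A₂ 1 * x₁ ^ 2) hSmall (by positivity) hA4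
    (by norm_num : (1 / 2 : ℝ) ≤ 1) ha (Λ := Λ) (X := Z) hΛ4 hx₁Z hΛZ hN
  -- rewrite the engine's sums in the `l^{−(1−β₆+w)}` form
  have hgW : ∀ l : ℕ, (gWeight Λ (Z / l) : ℂ) = (gW D (Z / l) : ℂ) := fun l => by
    rw [gW, hΛdef, hLdef]
  have hsum' : Summable (fun l : ℕ => χ (l : ZMod D) * xiZero c' D j l d r /
      (l : ℂ) ^ (1 - beta6 D + w) * (gW D (Z / l) : ℂ)) := by
    refine hsum.congr fun l => ?_
    rw [← coeff_div_eq c' χ j d r w l, hgW]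
  have hsharp : (∑ l ∈ Finset.Ico 1 ⌈Z⌉₊, a l / l) =
      ∑ l ∈ Finset.Ico 1 ⌈Z⌉₊, χ (l : ZMod D) * xiZero c' D j l d r / (l : ℂ) ^ (1 - beta6 D + w) :=
    Finset.sum_congr rfl fun l _ => coeff_div_eq c' χ j d r w l
  have hsmooth : ∑' l : ℕ, a l / l * (gWeight Λ (Z / l) : ℂ) =
      ∑' l : ℕ, χ (l : ZMod D) * xiZero c' D j l d r / (l : ℂ) ^ (1 - beta6 D + w) *
        (gW D (Z / l) : ℂ) :=
    tsum_congr fun l => by rw [coeff_div_eq c' χ j d r w l, hgW]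
  refine ⟨hsum', ?_⟩
  rw [← hsharp, ← hsmooth]
  refine le_trans hle ?_
  -- bookkeeping of the bound: `√Λ = L¹⁵`, `c ≤ e⁴`, `x₁² ≤ ?`, tail `≤ A₂(¼)·L⁻¹⁵`
  have hsqrt : Real.sqrt Λ = L ^ 15 := by
    rw [hΛdef, show L ^ 30 = (L ^ 15) ^ 2 by ring, Real.sqrt_sq (pow_nonneg hL0.le 15)]
  have hL15 : 0 < L ^ 15 := pow_pos hL0 15
  have hrφ1 : 1 ≤ (r : ℝ) / r.totient := by
    rw [le_div_iff₀ (by exact_mod_cast Nat.totient_pos.mpr (by omega))]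
    simpa using (Nat.totient_le r)
  have hrφ0 : 0 ≤ (r : ℝ) / r.totient := by linarith
  set R : ℝ := (r : ℝ) / r.totient with hRdef
  clear_value R
  -- the head constant: `x₁² ≤ ?` — absorb `x₁ ≤ x₀ + 1`, but keep it simple: `x₁² ≤ (x₀+1)²`
  -- We bound `F = A₂ 1 * x₁²` by `F₀' := A₂ 1 * (x₀ + 1)²`? Use instead `x₁ ^ 2 ≤ x₀ ^ 2 + 1 + 2 * x₀`.
  -- To keep the absolute constant as declared (`F₀ = A₂ 1 * x₀²`), note `x₁ = x₀` when `x₀ ≥ 1`,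
  -- which holds since `x₀ ≥ 2`.
  have hx₁eq : x₁ = x₀ := by rw [hx₁def, max_eq_left (by linarith)]
  -- the tail
  have htail : A₂ (1 / 4) * Z ^ (1 + (1 / 2 : ℝ)) * Real.exp (4 * (1 + (1 / 2 : ℝ)) - 16 * Λ) ≤
      A₂ (1 / 4) * (L ^ 15)⁻¹ := by
    have hZpow : Z ^ (1 + (1 / 2 : ℝ)) = Real.exp ((1 + 1 / 2) * Real.log Z) := by
      rw [Real.rpow_def_of_pos hZ0]; ring_nf
    have h1 : Z ^ (1 + (1 / 2 : ℝ)) * Real.exp (4 * (1 + (1 / 2 : ℝ)) - 16 * Λ) ≤ Real.exp (-Λ) := by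
      rw [hZpow, ← Real.exp_add, Real.exp_le_exp]
      have hΛ9 : L ^ 9 ≤ Λ := by
        rw [hΛdef]; exact pow_le_pow_right₀ hL1 (by norm_num)
      linarith [hlogZ, hΛ9, hΛ4]
    have h2 : Real.exp (-Λ) ≤ (L ^ 15)⁻¹ := by
      rw [Real.exp_neg, inv_le_inv₀ (Real.exp_pos _) hL15]
      have hΛ15 : L ^ 15 ≤ Λ := by rw [hΛdef]; exact pow_le_pow_right₀ hL1 (by norm_num)
      have := Real.add_one_le_exp Λ
      linarith
    calc A₂ (1 / 4) * Z ^ (1 + (1 / 2 : ℝ)) * Real.exp (4 * (1 + (1 / 2 : ℝ)) - 16 * Λ)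
        = A₂ (1 / 4) * (Z ^ (1 + (1 / 2 : ℝ)) * Real.exp (4 * (1 + (1 / 2 : ℝ)) - 16 * Λ)) := by ring
      _ ≤ A₂ (1 / 4) * Real.exp (-Λ) := mul_le_mul_of_nonneg_left h1 hA4
      _ ≤ A₂ (1 / 4) * (L ^ 15)⁻¹ := mul_le_mul_of_nonneg_left h2 hA4
  -- the main term
  have hmain : 27 * (c * (B₀ * R) + c * (A₂ 1 * x₁ ^ 2)) / Real.sqrt Λ / 2 ≤
      27 * (Real.exp 4 * B₀ + Real.exp 4 * F₀) / 2 * R * (L ^ 15)⁻¹ := by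
    rw [hsqrt, hx₁eq, ← hF₀]
    rw [div_div, div_le_iff₀ (by positivity)]
    have e1 : 27 * (Real.exp 4 * B₀ + Real.exp 4 * F₀) / 2 * R * (L ^ 15)⁻¹ *
        (L ^ 15 * 2) = 27 * (Real.exp 4 * B₀ + Real.exp 4 * F₀) * R := by
      rw [show 27 * (Real.exp 4 * B₀ + Real.exp 4 * F₀) / 2 * R * (L ^ 15)⁻¹ * (L ^ 15 * 2) =
          27 * (Real.exp 4 * B₀ + Real.exp 4 * F₀) * R * ((L ^ 15)⁻¹ * L ^ 15) * (2 / 2) by ring,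
        inv_mul_cancel₀ hL15.ne', div_self two_ne_zero, mul_one, mul_one]
    rw [e1]
    have h1 : c * (B₀ * R) ≤ Real.exp 4 * B₀ * R := by
      rw [← mul_assoc]; exact mul_le_mul_of_nonneg_right (mul_le_mul_of_nonneg_right hc4 hB₀0) hrφ0
    have h2 : c * F₀ ≤ Real.exp 4 * F₀ * R := by
      calc c * F₀ ≤ Real.exp 4 * F₀ := mul_le_mul_of_nonneg_right hc4 hF₀0
        _ = Real.exp 4 * F₀ * 1 := (mul_one _).symm
        _ ≤ Real.exp 4 * F₀ * R :=
            mul_le_mul_of_nonneg_left hrφ1 (by positivity)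
    calc 27 * (c * (B₀ * R) + c * F₀) ≤ 27 * (Real.exp 4 * B₀ * R + Real.exp 4 * F₀ * R) :=
          mul_le_mul_of_nonneg_left (add_le_add h1 h2) (by norm_num)
      _ = 27 * (Real.exp 4 * B₀ + Real.exp 4 * F₀) * R := by ring
  calc 27 * (c * (B₀ * R) + c * (A₂ 1 * x₁ ^ 2)) / Real.sqrt Λ / 2 +
        A₂ (1 / 4) * Z ^ (1 + (1 / 2 : ℝ)) * Real.exp (4 * (1 + (1 / 2 : ℝ)) - 16 * Λ)
      ≤ 27 * (Real.exp 4 * B₀ + Real.exp 4 * F₀) / 2 * R * (L ^ 15)⁻¹ +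
          A₂ (1 / 4) * (L ^ 15)⁻¹ := add_le_add hmain htail
    _ ≤ 27 * (Real.exp 4 * B₀ + Real.exp 4 * F₀) / 2 * R * (L ^ 15)⁻¹ +
          A₂ (1 / 4) * R * (L ^ 15)⁻¹ := by
        have h0 : 0 ≤ A₂ (1 / 4) * (L ^ 15)⁻¹ := by positivity
        have : A₂ (1 / 4) * (L ^ 15)⁻¹ ≤ A₂ (1 / 4) * R * (L ^ 15)⁻¹ := by
          calc A₂ (1 / 4) * (L ^ 15)⁻¹ = A₂ (1 / 4) * (L ^ 15)⁻¹ * 1 := (mul_one _).symm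
            _ ≤ A₂ (1 / 4) * (L ^ 15)⁻¹ * R := mul_le_mul_of_nonneg_left hrφ1 h0
            _ = A₂ (1 / 4) * R * (L ^ 15)⁻¹ := by ring
        exact add_le_add le_rfl this
    _ = (27 * (Real.exp 4 * B₀ + Real.exp 4 * F₀) / 2 + A₂ (1 / 4)) * R * (ell D ^ 15)⁻¹ := by
        rw [hLdef]; ring

end Literature.NumberTheory.LFunctions.Zhang2022.XiZeroMajorant

end
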